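import Mathlib
import Summits.BirchSwinnertonDyer.BirchSwinnertonDyer.Theorems.KatoDescentTamePotSupersingularTameLowerFibreAdjointH1Five

/-!
# Bricks for the `GL₂(𝔽₅)`-lifting route (T5′), VII: matrix calculus over dual numbers, and `Hom(GL₂(𝔽₅), 𝔽₅) = 0`

Continuation of `…TameLowerFibreAdjointBricksFive*` (same namespace). Two self-contained inputs of
the square-zero layer `𝔽₅[ε] → 𝔽₅` of the lifting statement (T5′) / (P′) of ARM-P audit r07 S7
ADDENDUM-1 §C (the next file proves that layer: every subgroup of `GL₂(𝔽₅[ε])` covering `GL₂(𝔽₅)`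
contains a conjugate of `GL₂(𝔽₅)`):

* the calculus of `n × n` matrices over the dual numbers `R[ε]` of a commutative ring, phrased with
  Mathlib's `Matrix.dualNumberEquiv : Matrix n n R[ε] ≃ₐ[R] (Matrix n n R)[ε]` and NO new definitions —
  `map_inr_mul_map_inr` (`εX · εY = 0`), `one_add_map_inr_mul_one_add_map_inr`
  (`(1 + εX)(1 + εY) = 1 + ε(X + Y)`), `mul_one_add_map_inr_mul`
  (`P (1 + εX) Q = 1 + ε P̄ X Q̄` when `P Q = 1`), `eq_one_add_map_inr_of_map_fst_eq_one`
  (the kernel of `GLₙ(R[ε]) → GLₙ(R)` is `1 + ε Mₙ(R)`), `map_fst_one_add_map_inr`;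
* `GL2F5_addChar_eq_zero`: every additive character `GL₂(𝔽₅) → 𝔽₅` (`φ(gh) = φ g + φ h`) vanishes —
  `d u d⁻¹ = u²`, `d v d⁻¹ = v³`, `d⁴ = 1` force `φ(u) = φ(v) = φ(d) = 0` for the generators of
  `GL2F5AdjointH1.eq_top_of_mem` (equivalently `H¹(GL₂(𝔽₅), 𝔽₅) = 0` for the trivial module, the
  scalar part of `H¹(GL₂(𝔽₅), 𝔤𝔩₂) = 0`).

Route-free, no definitions, nothing about elliptic curves or items 19618/19981 (open). Target
T-S7r07-1 (`FibreLatticeInput 5`).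
-/

set_option linter.dupNamespace false

open Matrix TrivSqZeroExt

namespace Summit.BirchSwinnertonDyer.BirchSwinnertonDyer.Theorems.GL2F5AdjointBricks

section dualcalc

variable {R : Type} [CommRing R] {n : Type} [Fintype n] [DecidableEq n]

/-- Under `Matrix.dualNumberEquiv`, the matrix `εX = X.map inr` is `inr X`. -/
theorem dualNumberEquiv_map_inr (X : Matrix n n R) :
    Matrix.dualNumberEquiv (X.map (TrivSqZeroExt.inr : R → DualNumber R)) = TrivSqZeroExt.inr X :=
  TrivSqZeroExt.ext rfl rfl

/-- Under `Matrix.dualNumberEquiv`, the matrix `M.map inl` is `inl M`. -/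
theorem dualNumberEquiv_map_inl (M : Matrix n n R) :
    Matrix.dualNumberEquiv (M.map (TrivSqZeroExt.inl : R → DualNumber R)) = TrivSqZeroExt.inl M :=
  TrivSqZeroExt.ext rfl rfl

/-- The first component of `Matrix.dualNumberEquiv M` is the entrywise first component. -/
theorem fst_dualNumberEquiv (M : Matrix n n (DualNumber R)) :
    (Matrix.dualNumberEquiv M).fst = M.map TrivSqZeroExt.fst := rfl

/-- The second component of `Matrix.dualNumberEquiv M` is the entrywise second component. -/
theorem snd_dualNumberEquiv (M : Matrix n n (DualNumber R)) :
    (Matrix.dualNumberEquiv M).snd = M.map TrivSqZeroExt.snd := rfl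

/-- `εX · εY = 0` for matrices over the dual numbers. -/
theorem map_inr_mul_map_inr (X Y : Matrix n n R) :
    X.map (TrivSqZeroExt.inr : R → DualNumber R) * Y.map TrivSqZeroExt.inr = 0 := by
  apply Matrix.dualNumberEquiv.injective
  rw [map_mul, map_zero, dualNumberEquiv_map_inr, dualNumberEquiv_map_inr, TrivSqZeroExt.inr_mul_inr]

omit [Fintype n] [DecidableEq n] in
/-- `ε(X + Y) = εX + εY`. -/
theorem map_inr_add (X Y : Matrix n n R) :
    (X + Y).map (TrivSqZeroExt.inr : R → DualNumber R) = X.map TrivSqZeroExt.inr + Y.map TrivSqZeroExt.inr := by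
  ext i j <;> simp

omit [Fintype n] [DecidableEq n] in
/-- `ε(-X) = -εX`. -/
theorem map_inr_neg (X : Matrix n n R) :
    (-X).map (TrivSqZeroExt.inr : R → DualNumber R) = -X.map TrivSqZeroExt.inr := by
  ext i j <;> simp

/-- `(1 + εX)(1 + εY) = 1 + ε(X + Y)`: the kernel of `GLₙ(R[ε]) → GLₙ(R)` is the additive group
`Mₙ(R)`. -/
theorem one_add_map_inr_mul_one_add_map_inr (X Y : Matrix n n R) :
    (1 + X.map (TrivSqZeroExt.inr : R → DualNumber R)) * (1 + Y.map TrivSqZeroExt.inr) =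
      1 + (X + Y).map TrivSqZeroExt.inr := by
  rw [add_mul, mul_add, mul_add, one_mul, mul_one, one_mul, map_inr_mul_map_inr, add_zero, map_inr_add]
  abel

/-- `(1 + εX)(1 - εX) = 1`. -/
theorem one_add_map_inr_mul_one_sub_map_inr (X : Matrix n n R) :
    (1 + X.map (TrivSqZeroExt.inr : R → DualNumber R)) * (1 - X.map TrivSqZeroExt.inr) = 1 := by
  rw [sub_eq_add_neg, ← map_inr_neg, one_add_map_inr_mul_one_add_map_inr, add_neg_cancel]
  ext i j <;> simp

/-- `(1 - εX)(1 + εX) = 1`. -/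
theorem one_sub_map_inr_mul_one_add_map_inr (X : Matrix n n R) :
    (1 - X.map (TrivSqZeroExt.inr : R → DualNumber R)) * (1 + X.map TrivSqZeroExt.inr) = 1 := by
  rw [sub_eq_add_neg, ← map_inr_neg, one_add_map_inr_mul_one_add_map_inr, neg_add_cancel]
  ext i j <;> simp

/-- **Conjugation acts on the kernel through the reduction**: if `P Q = 1` in `Mₙ(R[ε])` then
`P (1 + εX) Q = 1 + ε (P̄ X Q̄)`, `P̄ = P mod ε`. -/
theorem mul_one_add_map_inr_mul (P Q : Matrix n n (DualNumber R)) (X : Matrix n n R) (hPQ : P * Q = 1) :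
    P * (1 + X.map (TrivSqZeroExt.inr : R → DualNumber R)) * Q =
      1 + (P.map TrivSqZeroExt.fst * X * Q.map TrivSqZeroExt.fst).map TrivSqZeroExt.inr := by
  apply Matrix.dualNumberEquiv.injective
  have hPQ' : Matrix.dualNumberEquiv P * Matrix.dualNumberEquiv Q = 1 := by rw [← map_mul, hPQ, map_one]
  rw [map_mul, map_mul, map_add, map_one, dualNumberEquiv_map_inr, map_add, map_one, dualNumberEquiv_map_inr,
    mul_add, add_mul, mul_one, hPQ']
  congr 1
  refine TrivSqZeroExt.ext ?_ ?_
  · simp [TrivSqZeroExt.fst_mul]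
  · simp only [TrivSqZeroExt.snd_mul, TrivSqZeroExt.fst_mul, TrivSqZeroExt.fst_inr, TrivSqZeroExt.snd_inr,
      smul_eq_mul, op_smul_eq_mul, mul_zero, zero_mul, add_zero, zero_add,
      fst_dualNumberEquiv]

/-- **The kernel of `GLₙ(R[ε]) → GLₙ(R)` is `1 + ε Mₙ(R)`**: a matrix over `R[ε]` reducing to `1` is
`1 + ε (its ε-part)`. -/
theorem eq_one_add_map_inr_of_map_fst_eq_one (M : Matrix n n (DualNumber R)) (hM : M.map TrivSqZeroExt.fst = 1) :
    M = 1 + (M.map TrivSqZeroExt.snd).map TrivSqZeroExt.inr := by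
  apply Matrix.dualNumberEquiv.injective
  rw [map_add, map_one, dualNumberEquiv_map_inr]
  refine TrivSqZeroExt.ext ?_ ?_
  · rw [fst_dualNumberEquiv, hM, TrivSqZeroExt.fst_add, TrivSqZeroExt.fst_one, TrivSqZeroExt.fst_inr, add_zero]
  · rw [snd_dualNumberEquiv, TrivSqZeroExt.snd_add, TrivSqZeroExt.snd_one, TrivSqZeroExt.snd_inr, zero_add]

/-- `1 + εX` reduces to `1`. -/
theorem map_fst_one_add_map_inr (X : Matrix n n R) :
    (1 + X.map (TrivSqZeroExt.inr : R → DualNumber R)).map TrivSqZeroExt.fst = 1 := by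
  have h := fst_dualNumberEquiv (1 + X.map (TrivSqZeroExt.inr : R → DualNumber R))
  rw [map_add, map_one, dualNumberEquiv_map_inr, TrivSqZeroExt.fst_add, TrivSqZeroExt.fst_one,
    TrivSqZeroExt.fst_inr, add_zero] at h
  exact h.symm

omit [Fintype n] [DecidableEq n] in
/-- `M.map inl` reduces to `M`. -/
theorem map_fst_map_inl (M : Matrix n n R) :
    (M.map (TrivSqZeroExt.inl : R → DualNumber R)).map TrivSqZeroExt.fst = M := by
  ext i j; simp

end dualcalc

section addchar

/-- **`Hom(GL₂(𝔽₅), 𝔽₅) = 0`**: an additive character of `GL₂(𝔽₅)` with values in `𝔽₅` vanishes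
(the abelianisation of `GL₂(𝔽₅)` is `𝔽₅ˣ`, of order prime to `5`). Proof on generators: with
`u = (1 1; 0 1)`, `v = (1 0; 1 1)`, `d = diag(2, 1)` one has `d u d⁻¹ = u²`, `d v d⁻¹ = v³`, `d⁴ = 1`,
forcing `φ u = φ v = φ d = 0`, and `{φ = 0}` is a subgroup (`GL2F5AdjointH1.eq_top_of_mem`). -/
theorem GL2F5_addChar_eq_zero (φ : GL (Fin 2) (ZMod 5) → ZMod 5)
    (hφ : ∀ g h : GL (Fin 2) (ZMod 5), φ (g * h) = φ g + φ h) (g : GL (Fin 2) (ZMod 5)) : φ g = 0 := by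
  set u : GL (Fin 2) (ZMod 5) := ⟨!![1, 1; 0, 1], !![1, 4; 0, 1], by decide, by decide⟩ with u_def
  set v : GL (Fin 2) (ZMod 5) := ⟨!![1, 0; 1, 1], !![1, 0; 4, 1], by decide, by decide⟩ with v_def
  set d : GL (Fin 2) (ZMod 5) := ⟨!![2, 0; 0, 1], !![3, 0; 0, 1], by decide, by decide⟩ with d_def
  have φ_one : φ 1 = 0 := by
    have h := hφ 1 1; rw [one_mul] at h
    linear_combination -h
  have φ_inv : ∀ x, φ x⁻¹ = -φ x := by
    intro x
    have h := hφ x⁻¹ x; rw [inv_mul_cancel, φ_one] at h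
    linear_combination -h
  have φ_pow : ∀ x (k : ℕ), φ (x ^ k) = k * φ x := by
    intro x k
    induction k with
    | zero => rw [pow_zero, φ_one, Nat.cast_zero, zero_mul]
    | succ k ih => rw [pow_succ, hφ, ih]; push_cast; ring
  have rel_u : d * u * d⁻¹ = u ^ 2 := by decide
  have rel_v : d * v * d⁻¹ = v ^ 3 := by decide
  have rel_d : d ^ 4 = 1 := by decide
  have hu : φ u = 0 := by
    have h := congrArg φ rel_u
    rw [hφ, hφ, φ_inv, φ_pow] at h
    push_cast at h
    linear_combination -h
  have hv : φ v = 0 := by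
    have h := congrArg φ rel_v
    rw [hφ, hφ, φ_inv, φ_pow] at h
    push_cast at h
    have h2 : (2 : ZMod 5) * φ v = 0 := by linear_combination -h
    have h6 : (6 : ZMod 5) = 1 := by decide
    calc φ v = (6 : ZMod 5) * φ v := by rw [h6, one_mul]
      _ = 3 * ((2 : ZMod 5) * φ v) := by ring
      _ = 0 := by rw [h2, mul_zero]
  have hd : φ d = 0 := by
    have h := congrArg φ rel_d
    rw [φ_pow, φ_one] at h
    push_cast at h
    have h16 : (16 : ZMod 5) = 1 := by decide
    calc φ d = (16 : ZMod 5) * φ d := by rw [h16, one_mul]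
      _ = 4 * ((4 : ZMod 5) * φ d) := by ring
      _ = 0 := by rw [h, mul_zero]
  let Z : Subgroup (GL (Fin 2) (ZMod 5)) :=
    { carrier := {x | φ x = 0}
      mul_mem' := by
        intro x y hx hy
        simp only [Set.mem_setOf_eq] at hx hy ⊢
        rw [hφ, hx, hy, add_zero]
      one_mem' := φ_one
      inv_mem' := by
        intro x hx
        simp only [Set.mem_setOf_eq] at hx ⊢
        rw [φ_inv, hx, neg_zero] }
  have hZ : Z = ⊤ := by
    refine GL2F5AdjointH1.eq_top_of_mem Z ?_ ?_ ?_
    · intro x hx; have : x = u := Units.ext hx; subst this; exact hu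
    · intro x hx; have : x = v := Units.ext hx; subst this; exact hv
    · intro x hx; have : x = d := Units.ext hx; subst this; exact hd
  have hg : g ∈ Z := hZ ▸ Subgroup.mem_top g
  exact hg

end addchar

end Summit.BirchSwinnertonDyer.BirchSwinnertonDyer.Theorems.GL2F5AdjointBricks
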